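import Summits.HubbardSuperconductivity.HubbardSuperconductivity.Theses.AposterioriCapRg
import Summits.HubbardSuperconductivity.HubbardSuperconductivity.Theorems.FixedPointDWaveOrder.Negative.BelowBandNoOrder
import Summits.HubbardSuperconductivity.HubbardSuperconductivity.Theorems.AposterioriOrderCriterionR.Negative.EmptyShell
import HarnessLib

/-!
# `AposterioriOrderCriterionR` below the band edge (frame witness X1 at the statement level)

Crux `stmt-HubbardSuperconductivity-13884` (route AposterioriCapRg, decl
`Theses.AposterioriCapRg.AposterioriOrderCriterionR`, "R"), line lead attempt 1, 2026-08-16. Negative-side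
support lemmas; nothing here asserts or refutes a Theses declaration unconditionally.

R compares two independently defined objects at the same letter `μ`:
* HYPOTHESIS — the Grassmann report `hubbardScaleReportCT U μ D h` of `HubbardScaleReportCT.lean`, built on the plain
  quartic vertex `hubbardInteraction` (no density counterterm), the symmetric Matsubara set `{-M,…,M-1}` and the
  covariance `1/(iω-ξ)` without convergence factor (`HubbardFreeCovariance.lean`: the functional-integral identity is
  NOT asserted); with that equal-time convention every density loop is the midpoint `n - ½`
  (`Cruxes/AposterioriOrderCriterionR/DrefuteTadpole.lean`), so as `M → ∞` the report describes the OPERATOR model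
  `U(n↑-½)(n↓-½)`, i.e. `dWaveSourceTorus L U (μ + U/2) h`;
* CONCLUSION — the operator order parameter `dWaveOrderParameter U μ` of `dWaveSourceTorus L U μ h`.

Below the band edge the two sides separate completely, and the tree can now say so on both sides:

* `fst_nonpos_of_aposterioriOrderCriterionR_belowBand` — IF R holds (thresholds `kStar, etaStar`) then at every
  `U ≥ 0`, `μ < -4`, `h₀ > 0`, every scale datum that is an `h`-uniformly certified enclosure of the CT report on
  `(0, h₀]` and meets the thresholds has `D.meanFieldDensity.fst ≤ 0` — because the conclusion side is the sourced
  VACUUM, `dWaveOrderParameter U μ = 0` (tree `FixedPointDWaveOrder.Negative.dWaveOrderParameter_eq_zero_below_band`);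
  equivalently (`not_certified_of_aposterioriOrderCriterionR_belowBand`) no datum with a positive floor meeting R's
  thresholds is ever `h`-uniformly certified there — R forbids, for free, every certificate of the route's own format
  reporting order for the repulsive model read at operator chemical potential `μ + U/2 ∈ (-4, 4)`
  (`2(-4-μ) < U < 2(4-μ)`, e.g. `(U, μ) = (8, -5)` reads `μ' = -1`);
* `isRealisedAtCT_bare_belowBand`, `report_belowBand_nonempty` — and the hypothesis side there is NOT an empty report:
  for `μ ≤ -4 - Λ₀` already the BARE frame `K = 0` has an empty scale-`Λ₀` shell (`ξ_k = ε_k - μ ≥ Λ₀`), so at every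
  coupling `U`, every `L ≥ 1`, `M`, `β > 0` and every source `h` the CT predicate is realised with ZERO remainder by the
  responses of the fully integrated (Matsubara-truncated) Grassmann functional
  (`AposterioriOrderCriterionR.Negative.isRealisedAtCT_of_emptyShell`, `mfFreeEnergyCT_of_emptyShell`): the `m₀` that R
  binds below the band is the genuine anomalous density of the plain-quartic Grassmann model at `μ`.

Repair is the planner's: conclusion at `μ + U/2` (and the operator density clause of `CapRgSymmetricCertificatePinned`
read there), or the `(U/2)(βL²)⁻¹Σ_{kσ}ψ̂⁺ψ̂⁻` counterterm in `hubbardInteraction` so that Grassmann `μ` = operator `μ`.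
-/

namespace Summit.HubbardSuperconductivity.HubbardSuperconductivity.Theorems.AposterioriOrderCriterionR.Negative

open Literature.MathematicalPhysics.QuantumLattice Literature.Probability.LatticeModels
open Summit.HubbardSuperconductivity.HubbardSuperconductivity.Theses.AposterioriCapRg
open Summit.HubbardSuperconductivity.FixedPointDWaveOrder.Negative
open Filter Set

noncomputable section

/-! ### Conclusion side: R pins every certified floor below the band edge to `≤ 0` -/

/-- **R forbids certified reported order below the band edge.** If `AposterioriOrderCriterionR` holds with
thresholds `(kStar, etaStar)`, then for every `U ≥ 0`, `μ < -4`, `h₀ > 0` and every scale datum `D` that is an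
`h`-uniformly certified enclosure of `hubbardScaleReportCT U μ D h`, `h ∈ (0, h₀]`, meeting those thresholds,
`D.meanFieldDensity.fst ≤ 0`: the conclusion side of R is the sourced vacuum
(`dWaveOrderParameter_eq_zero_below_band`), whatever the Grassmann report at `μ` — the operator model at `μ + U/2` —
certifies. [cite: KomaTasaki1994, §1] -/
theorem fst_nonpos_of_aposterioriOrderCriterionR_belowBand (hR : AposterioriOrderCriterionR) :
    ∃ kStar etaStar : ℚ, 0 < kStar ∧ 0 < etaStar ∧ ∀ (U μ h₀ : ℝ) (D : HubbardScaleData), 0 ≤ U → μ < -4 → 0 < h₀ →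
      (∀ h ∈ Set.Ioc (0:ℝ) h₀, ∃ L₀ : ℕ, D.IsCertifiedEnclosure (hubbardScaleReportCT U μ D h) L₀) →
      D.MeetsThresholds kStar etaStar → D.meanFieldDensity.fst ≤ 0 := by
  obtain ⟨kStar, etaStar, hk, he, hall⟩ := hR
  refine ⟨kStar, etaStar, hk, he, fun U μ h₀ D hU hμ hh₀ hcert hthr => ?_⟩
  have hle := hall U μ h₀ D hh₀ hcert hthr
  rw [dWaveOrderParameter_eq_zero_below_band hU hμ] at hle
  have : ((D.meanFieldDensity.fst : ℚ) : ℝ) ≤ 0 := by linarith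
  exact_mod_cast this

/-- The same, as a non-certifiability statement: under R (thresholds `kStar, etaStar`), at `U ≥ 0`, `μ < -4` NO scale
datum with a positive mean-field floor that meets the thresholds is an `h`-uniformly certified enclosure of the CT
report on any source window `(0, h₀]`. [cite: KomaTasaki1994, §1] -/
theorem not_certified_of_aposterioriOrderCriterionR_belowBand (hR : AposterioriOrderCriterionR) :
    ∃ kStar etaStar : ℚ, 0 < kStar ∧ 0 < etaStar ∧ ∀ (U μ h₀ : ℝ) (D : HubbardScaleData), 0 ≤ U → μ < -4 → 0 < h₀ →
      D.MeetsThresholds kStar etaStar → 0 < D.meanFieldDensity.fst →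
      ¬ ∀ h ∈ Set.Ioc (0:ℝ) h₀, ∃ L₀ : ℕ, D.IsCertifiedEnclosure (hubbardScaleReportCT U μ D h) L₀ := by
  obtain ⟨kStar, etaStar, hk, he, hall⟩ := fst_nonpos_of_aposterioriOrderCriterionR_belowBand hR
  refine ⟨kStar, etaStar, hk, he, fun U μ h₀ D hU hμ hh₀ hthr hpos hcert => ?_⟩
  exact absurd (hall U μ h₀ D hU hμ hh₀ hcert hthr) (not_le.2 hpos)

/-! ### Hypothesis side: below the band the report is the fully integrated Grassmann functional, already in the bare frame -/

/-- Below the band by at least the scale, `μ ≤ -4 - Λ₀`, the BARE frame `K = 0` has an empty scale-`Λ₀` shell on every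
torus: `Λ₀ ≤ |e_0(k)| = |ε_k - μ|` for every momentum (`ε_k ≥ -4`). [folklore] -/
theorem le_abs_nambuXiCT_zero_of_le (L : ℕ) {μ Λ₀ : ℝ} (hμ : μ ≤ -4 - Λ₀) (k : TorusSite 2 L) :
    Λ₀ ≤ |nambuXiCT L μ 0 k| := by
  rw [nambuXiCT_zero_frame, nambuXi]
  have := neg_four_le_torusBand L k
  exact le_trans (by linarith) (le_abs_self _)

/-- **The CT predicate is realised below the band in the bare frame, at every coupling, with zero remainder.** For
`μ ≤ -4 - Λ₀`, `Λ₀ > 0`, every `U, h`, every `L ≥ 1`, `M` and `β > 0`, the no-patch tuple of fully integrated responses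
`(ρ_s, κ, m₀) = (scaleStiffnessCT, scaleCompressibilityCT, scaleMeanFieldDensityCT) L M β U μ h 0 Λ₀` (arbitrary
velocities, remainder `0`) satisfies `IsRealisedAtCT L M β U μ h 0 Λ₀ 0 ∅`: nothing is truncated
(`mfFreeEnergyCT_of_emptyShell`), so the `m₀` R binds there is the anomalous density of the plain-quartic,
Matsubara-truncated Grassmann model at `μ` itself. [folklore] -/
theorem isRealisedAtCT_bare_belowBand (L M : ℕ) [NeZero L] {μ Λ₀ β : ℝ} (hΛ : 0 < Λ₀) (hμ : μ ≤ -4 - Λ₀)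
    (hβ : 0 < β) (U h vF vΔ : ℝ) :
    IsRealisedAtCT L M β U μ h 0 Λ₀ 0 ∅
      ⟨Fin.elim0, scaleStiffnessCT L M β U μ h 0 Λ₀, scaleCompressibilityCT L M β U μ h 0 Λ₀, vF, vΔ, 0,
        scaleMeanFieldDensityCT L M β U μ h 0 Λ₀⟩ :=
  isRealisedAtCT_of_emptyShell hΛ (le_abs_nambuXiCT_zero_of_le L hμ) hβ U h vF vΔ

/-- **Hence the hypothesis side of R below the band is never the empty report at finite `M`**: for a no-patch datum
`D` (`D.numPatches = 0`) with `D.scale ≤ -4 - μ`, at every `U, h`, `L ≥ 1`, `M`, `β > 0` the realised set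
`{p | IsRealisedAtCT L M β U μ h 0 D.scale 0 ∅ p}` whose Kuratowski upper limit in `M` is
`hubbardScaleReportCT U μ D h L β` (`mem_hubbardScaleReportCTAt_iff`, bare frame admissible) is inhabited.
[folklore] -/
theorem realised_belowBand_nonempty (D : HubbardScaleData) (hNp : D.numPatches = 0) {μ : ℝ}
    (hμ : μ ≤ -4 - (D.scale : ℝ)) (U h : ℝ) (L M : ℕ) [NeZero L] {β : ℝ} (hβ : 0 < β) :
    ∃ p : HubbardScaleData.Parameters 0, IsRealisedAtCT L M β U μ h 0 (D.scale : ℝ) 0 (hNp ▸ D.nodal) p := by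
  have hnod : (hNp ▸ D.nodal : Finset (Fin 0)) = ∅ := Finset.eq_empty_of_isEmpty _
  rw [hnod]
  exact ⟨_, isRealisedAtCT_bare_belowBand L M D.cast_scale_pos hμ hβ U h 0 0⟩

end

end Summit.HubbardSuperconductivity.HubbardSuperconductivity.Theorems.AposterioriOrderCriterionR.Negative
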